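import Mathlib
import Summits.ValiantsHypothesis.ValiantsHypothesis.Theorems.LacunarySymmetroidMatrixDescartesInertiaBand

/-!
# `MatrixDescartes` (stmt-ValiantsHypothesis-18050) — THE TWO-BLOCK DOMINANCE LEMMA: the inertia of
# `[[C₁₁ + diag(small⁺), C₁₂], [C₁₂ᵀ, C₂₂ − diag(huge⁺)]]` is `(|ρ₁| − ν(C₁₁), |ρ₂| + ν(C₁₁), 0)`

HONEST FRAMING.  Cell `pub-symmetroid`, seat `val-sym-mdr-p2` (gen 21); helper file `--supports` the crux
`Theses.LacunarySymmetroid.MatrixDescartes` (OPEN), NO closure claim.  Pure linear algebra (Sylvester's law in the family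
language of `…InertiaKit`) — the END ASYMPTOTICS of the dual of a two-sided monotone signed word at BOTH ends (`x → ∞`
directly, `x → 0⁺` after negation and block swap), i.e. the engine of THE EXACT MONOTONE COUNT `Z₊ = ν(C₊₊) + π(C₋₋)`
(filed next, `…MonotoneExact`).  Nothing here bears on the crux in its window, `stub_twoSided`, `DoorA26` / `DoorA34`,
registers, or `VP ≠ VNP`.

THE FAMILY.  `C₁₁ : ρ₁ × ρ₁`, `C₂₂ : ρ₂ × ρ₂` real symmetric, `C₁₂ : ρ₁ × ρ₂` arbitrary; weights `αⱼ, βⱼ > 0`, exponents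
`pⱼ, qⱼ ≥ 1`;  `M(s) = [[C₁₁ + diag(αⱼ s^{pⱼ}), C₁₂], [C₁₂ᵀ, C₂₂ − diag((βⱼ s^{qⱼ})⁻¹)]]`  (`s > 0`: a SMALL positive
diagonal on the first block, a HUGE negative diagonal on the second).

* `card_nonneg_le_posIndex_fromBlocks` — for ANY positive diagonal `a` on the first block and any bordering,
  `π([[C₁₁ + diag a, X], [Y, Z]]) ≥ #{λ(C₁₁) ≥ 0} = |ρ₁| − ν(C₁₁)` (the non-negative eigenvectors of `C₁₁`, extended by zero,
  are a positive family).
* `exists_negIndex_twoBlock_ge` — for `s ∈ (0, ε)`: `ν(M(s)) ≥ |ρ₂| + ν(C₁₁)`.  Mechanism: the diagonal congruence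
  `Λ = 1 ⊕ diag(uⱼ)`, `uⱼ = √(βⱼ s^{qⱼ})`, gives `Λ M(s) Λ = K(s) = [[C₁₁ + diag(αs^p), C₁₂ diag u], [diag u C₁₂ᵀ,
  diag u C₂₂ diag u − 1]]`, an entrywise CONTINUOUS family on `ℝ` with `K(0) = [[C₁₁, 0], [0, −1]]`; the negative
  eigenvectors of `C₁₁` together with the standard vectors of the second block are a negative family for `K(0)`, hence for
  `K(s)` near `0` (persistence `Inertia.eventually_neg_family`), and their span is `Λ`-invariant.
* **`inertia_twoBlock` (THE TWO-BLOCK DOMINANCE LEMMA).**  There is `ε > 0` such that for all `s ∈ (0, ε)`: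
  `ν(M(s)) = |ρ₂| + ν(C₁₁)`, `π(M(s)) = |ρ₁| − ν(C₁₁)`, and `det M(s) ≠ 0`.
  The second block and the NEGATIVE part of `C₁₁` go down, the NON-NEGATIVE part of `C₁₁` (kernel included) goes up; `C₁₂`
  and `C₂₂` are irrelevant.  (Haynsworth reading: the second block is `≺ 0` and the Schur complement is `C₁₁ +` a small
  POSITIVE DEFINITE correction.)

[folklore] (Sylvester's law of inertia; persistence of definite families).  Axioms `propext`, `Classical.choice`,
`Quot.sound`.  No definitions.
-/

-- layout Summits/ValiantsHypothesis/ValiantsHypothesis forces the duplicated namespace component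
set_option linter.dupNamespace false

namespace Summit.ValiantsHypothesis.ValiantsHypothesis.Theorems.LacunarySymmetroidMatrixDescartes

open Matrix Finset
open scoped BigOperators Topology

namespace Inertia

section TwoBlock

variable {ρ₁ ρ₂ : Type} [Fintype ρ₁] [DecidableEq ρ₁] [Fintype ρ₂] [DecidableEq ρ₂]

/-- the two-block family `M(s)` (file-local notation) -/
local notation3 (prettyPrint := false) "𝕄[" C₁₁ ", " C₁₂ ", " C₂₂ ", " α ", " p ", " β ", " q ", " s "]" =>
  Matrix.fromBlocks ((C₁₁ : Matrix _ _ ℝ) + Matrix.diagonal (fun j => (α : _ → ℝ) j * (s : ℝ) ^ ((p : _ → ℕ) j)))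
    (C₁₂ : Matrix _ _ ℝ) (C₁₂)ᵀ
    ((C₂₂ : Matrix _ _ ℝ) - Matrix.diagonal (fun j => ((β : _ → ℝ) j * (s : ℝ) ^ ((q : _ → ℕ) j))⁻¹))

/-- the rescaling weights `uⱼ(s) = √(βⱼ s^{qⱼ})` (file-local notation) -/
local notation3 (prettyPrint := false) "𝕦[" β ", " q ", " s "]" =>
  (fun j => Real.sqrt ((β : _ → ℝ) j * (s : ℝ) ^ ((q : _ → ℕ) j)))

/-- the rescaled family `K(s) = Λ M(s) Λ` (file-local notation) -/
local notation3 (prettyPrint := false) "𝕂[" C₁₁ ", " C₁₂ ", " C₂₂ ", " α ", " p ", " β ", " q ", " s "]" =>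
  Matrix.fromBlocks ((C₁₁ : Matrix _ _ ℝ) + Matrix.diagonal (fun j => (α : _ → ℝ) j * (s : ℝ) ^ ((p : _ → ℕ) j)))
    ((C₁₂ : Matrix _ _ ℝ) * Matrix.diagonal (𝕦[β, q, s]))
    (Matrix.diagonal (𝕦[β, q, s]) * (C₁₂)ᵀ)
    (Matrix.diagonal (𝕦[β, q, s]) * (C₂₂ : Matrix _ _ ℝ) * Matrix.diagonal (𝕦[β, q, s]) - 1)

/-! ## §1  Symmetry, combinations of embedded families -/

omit [Fintype ρ₁] [Fintype ρ₂] in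
/-- The two-block family is symmetric. [folklore] -/
theorem isHermitian_twoBlock {C₁₁ : Matrix ρ₁ ρ₁ ℝ} {C₂₂ : Matrix ρ₂ ρ₂ ℝ} (h₁ : C₁₁.IsSymm) (h₂ : C₂₂.IsSymm)
    (C₁₂ : Matrix ρ₁ ρ₂ ℝ) (α : ρ₁ → ℝ) (p : ρ₁ → ℕ) (β : ρ₂ → ℝ) (q : ρ₂ → ℕ) (s : ℝ) :
    (𝕄[C₁₁, C₁₂, C₂₂, α, p, β, q, s]).IsHermitian := by
  refine isHermitian_of_isSymm ?_
  rw [Matrix.isSymm_fromBlocks_iff]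
  exact ⟨h₁.add (Matrix.isSymm_diagonal _), rfl, Matrix.transpose_transpose _, h₂.sub (Matrix.isSymm_diagonal _)⟩

omit [Fintype ρ₁] in
/-- The rescaled family is symmetric. [folklore] -/
theorem isHermitian_rescaled {C₁₁ : Matrix ρ₁ ρ₁ ℝ} {C₂₂ : Matrix ρ₂ ρ₂ ℝ} (h₁ : C₁₁.IsSymm) (h₂ : C₂₂.IsSymm)
    (C₁₂ : Matrix ρ₁ ρ₂ ℝ) (α : ρ₁ → ℝ) (p : ρ₁ → ℕ) (β : ρ₂ → ℝ) (q : ρ₂ → ℕ) (s : ℝ) :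
    (𝕂[C₁₁, C₁₂, C₂₂, α, p, β, q, s]).IsHermitian := by
  refine isHermitian_of_isSymm ?_
  rw [Matrix.isSymm_fromBlocks_iff]
  refine ⟨h₁.add (Matrix.isSymm_diagonal _), ?_, ?_, ?_⟩
  · rw [Matrix.transpose_mul, Matrix.diagonal_transpose]
  · rw [Matrix.transpose_mul, Matrix.diagonal_transpose, Matrix.transpose_transpose]
  · refine Matrix.IsSymm.sub ?_ Matrix.isSymm_one
    unfold Matrix.IsSymm
    rw [Matrix.transpose_mul, Matrix.transpose_mul, Matrix.diagonal_transpose, h₂.eq, Matrix.mul_assoc]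

omit [Fintype ρ₁] [Fintype ρ₂] [DecidableEq ρ₁] [DecidableEq ρ₂] in
/-- Combination of a family embedded in the first block: `Σ cᵢ (bᵢ, 0) = (Σ cᵢ bᵢ, 0)`. [folklore] -/
theorem sum_smul_inl {α : Type} [Fintype α] (b : α → ρ₁ → ℝ) (c : α → ℝ) :
    (∑ i, c i • (Sum.elim (b i) (0 : ρ₂ → ℝ))) = Sum.elim (∑ i, c i • b i) (0 : ρ₂ → ℝ) := by
  funext k
  rw [Finset.sum_apply]
  cases k with
  | inl a => simp only [Sum.elim_inl, Pi.smul_apply, smul_eq_mul, Finset.sum_apply]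
  | inr r => simp only [Sum.elim_inr, Pi.smul_apply, Pi.zero_apply, smul_eq_mul, mul_zero, Finset.sum_const_zero]

omit [Fintype ρ₁] [Fintype ρ₂] [DecidableEq ρ₁] [DecidableEq ρ₂] in
/-- Combination of a family embedded in the second block: `Σ cᵢ (0, bᵢ) = (0, Σ cᵢ bᵢ)`. [folklore] -/
theorem sum_smul_inr {α : Type} [Fintype α] (b : α → ρ₂ → ℝ) (c : α → ℝ) :
    (∑ i, c i • (Sum.elim (0 : ρ₁ → ℝ) (b i))) = Sum.elim (0 : ρ₁ → ℝ) (∑ i, c i • b i) := by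
  funext k
  rw [Finset.sum_apply]
  cases k with
  | inl a => simp only [Sum.elim_inl, Pi.smul_apply, Pi.zero_apply, smul_eq_mul, mul_zero, Finset.sum_const_zero]
  | inr r => simp only [Sum.elim_inr, Pi.smul_apply, smul_eq_mul, Finset.sum_apply]

omit [Fintype ρ₁] [DecidableEq ρ₁] in
/-- Combination of the JOINT family (first-block vectors `bᵢ`, standard vectors of the second block):
`Σ_k c_k Φ_k = (Σᵢ c_{inl i} bᵢ, (c_{inr j})ⱼ)`. [folklore] -/
theorem sum_smul_joint {α : Type} [Fintype α] (b : α → ρ₁ → ℝ) (c : α ⊕ ρ₂ → ℝ) :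
    (∑ k, c k • Sum.elim (fun i => Sum.elim (b i) (0 : ρ₂ → ℝ))
        (fun j => Sum.elim (0 : ρ₁ → ℝ) (Pi.single j (1 : ℝ))) k)
      = Sum.elim (∑ i, c (Sum.inl i) • b i) (fun j => c (Sum.inr j)) := by
  rw [Fintype.sum_sum_type]
  simp only [Sum.elim_inl, Sum.elim_inr]
  rw [sum_smul_inl, sum_smul_inr]
  funext k
  cases k with
  | inl a => simp only [Pi.add_apply, Sum.elim_inl, Pi.zero_apply, add_zero]
  | inr r =>
    simp only [Pi.add_apply, Sum.elim_inr, Pi.zero_apply, zero_add, Finset.sum_apply, Pi.smul_apply,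
      Pi.single_apply, smul_eq_mul, mul_ite, mul_one, mul_zero, Finset.sum_ite_eq, Finset.mem_univ, if_true]

/-! ## §2  The positive family: `π ≥ #{λ(C₁₁) ≥ 0}` for any positive first-block diagonal -/

/-- **The non-negative eigenvectors of `C₁₁`, extended by zero, are a positive family** for every symmetric block matrix
`[[C₁₁ + diag a, X], [Y, Z]]` with `a > 0`:  `#{λ(C₁₁) ≥ 0} ≤ π`. [folklore] -/
theorem card_nonneg_le_posIndex_fromBlocks {C₁₁ : Matrix ρ₁ ρ₁ ℝ} (hC : C₁₁.IsHermitian) (a : ρ₁ → ℝ)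
    (ha : ∀ j, 0 < a j) (X : Matrix ρ₁ ρ₂ ℝ) (Y : Matrix ρ₂ ρ₁ ℝ) (Z : Matrix ρ₂ ρ₂ ℝ)
    (hM : (Matrix.fromBlocks (C₁₁ + Matrix.diagonal a) X Y Z).IsHermitian) :
    Fintype.card {j // 0 ≤ hC.eigenvalues j} ≤ Fintype.card {j // 0 < hM.eigenvalues j} := by
  classical
  refine card_le_posIndex hM (fun i : {j // 0 ≤ hC.eigenvalues j} => Sum.elim (hC.eigenvectorBasis i.1).ofLp 0)
    fun c hc => ?_
  set w := ∑ i, c i • (hC.eigenvectorBasis i.1).ofLp with hw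
  have hw0 : w ≠ 0 := by
    intro h0
    have hli := linearIndependent_subtype_eigen hC (fun j => 0 ≤ hC.eigenvalues j)
    rw [Fintype.linearIndependent_iff] at hli
    exact hc (funext fun i => hli c h0 i)
  rw [sum_smul_inl, Matrix.fromBlocks_mulVec, Matrix.dotProduct_block, Sum.elim_comp_inl, Sum.elim_comp_inr,
    Sum.elim_comp_inl, Sum.elim_comp_inr]
  simp only [Matrix.mulVec_zero, add_zero, zero_dotProduct]
  rw [Matrix.add_mulVec, dotProduct_add, ← hw]
  have hgram : 0 ≤ w ⬝ᵥ (C₁₁ *ᵥ w) := nonneg_eigenFamily hC c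
  have hdiag : 0 < w ⬝ᵥ (Matrix.diagonal a *ᵥ w) := by
    have hform : w ⬝ᵥ (Matrix.diagonal a *ᵥ w) = ∑ j, a j * w j ^ 2 := by
      rw [dotProduct]
      refine Finset.sum_congr rfl fun j _ => ?_
      rw [Matrix.mulVec_diagonal]
      ring
    rw [hform]
    obtain ⟨j₀, hj₀⟩ : ∃ j, w j ≠ 0 := by
      by_contra h
      push Not at h
      exact hw0 (funext h)
    exact lt_of_lt_of_le (mul_pos (ha j₀) (by positivity))
      (Finset.single_le_sum (fun j _ => mul_nonneg (ha j).le (sq_nonneg (w j))) (Finset.mem_univ j₀))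
  exact add_pos_of_nonneg_of_pos hgram hdiag

/-! ## §3  The rescaled family: continuity, value at `0`, the congruence `Λᵀ M(s) Λ = K(s)` -/

omit [Fintype ρ₁] in
/-- The rescaled family has continuous entries. [folklore] -/
theorem continuous_rescaled (C₁₁ : Matrix ρ₁ ρ₁ ℝ) (C₁₂ : Matrix ρ₁ ρ₂ ℝ) (C₂₂ : Matrix ρ₂ ρ₂ ℝ) (α : ρ₁ → ℝ)
    (p : ρ₁ → ℕ) (β : ρ₂ → ℝ) (q : ρ₂ → ℕ) (i k : ρ₁ ⊕ ρ₂) :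
    Continuous fun s : ℝ => (𝕂[C₁₁, C₁₂, C₂₂, α, p, β, q, s]) i k := by
  have hu : ∀ j, Continuous fun s : ℝ => Real.sqrt (β j * s ^ q j) := fun j =>
    Real.continuous_sqrt.comp (continuous_const.mul (continuous_pow _))
  rcases i with i | i <;> rcases k with k | k
  · simp only [Matrix.fromBlocks_apply₁₁, Matrix.add_apply, Matrix.diagonal_apply]
    split_ifs <;> fun_prop
  · simp only [Matrix.fromBlocks_apply₁₂, Matrix.mul_diagonal]
    exact continuous_const.mul (hu k)
  · simp only [Matrix.fromBlocks_apply₂₁, Matrix.diagonal_mul]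
    exact (hu i).mul continuous_const
  · simp only [Matrix.fromBlocks_apply₂₂, Matrix.sub_apply, Matrix.mul_diagonal, Matrix.diagonal_mul]
    exact (((hu i).mul continuous_const).mul (hu k)).sub continuous_const

omit [Fintype ρ₁] in
/-- The rescaled family at `s = 0` is `[[C₁₁, 0], [0, −1]]` (`pⱼ, qⱼ ≥ 1`). [folklore] -/
theorem rescaled_zero (C₁₁ : Matrix ρ₁ ρ₁ ℝ) (C₁₂ : Matrix ρ₁ ρ₂ ℝ) (C₂₂ : Matrix ρ₂ ρ₂ ℝ) (α : ρ₁ → ℝ)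
    {p : ρ₁ → ℕ} (β : ρ₂ → ℝ) {q : ρ₂ → ℕ} (hp : ∀ j, 1 ≤ p j) (hq : ∀ j, 1 ≤ q j) :
    𝕂[C₁₁, C₁₂, C₂₂, α, p, β, q, (0 : ℝ)] = Matrix.fromBlocks C₁₁ 0 0 (-1) := by
  have hu : (fun j => Real.sqrt (β j * (0 : ℝ) ^ q j)) = fun _ => 0 := by
    funext j
    rw [zero_pow (by have := hq j; omega), mul_zero, Real.sqrt_zero]
  have hd : Matrix.diagonal (fun j => α j * (0 : ℝ) ^ p j) = 0 := by
    rw [← Matrix.diagonal_zero]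
    congr 1
    funext j
    rw [zero_pow (by have := hp j; omega), mul_zero]
  rw [hu, hd, Matrix.diagonal_zero, Matrix.mul_zero, Matrix.zero_mul, Matrix.zero_mul, Matrix.mul_zero, add_zero,
    zero_sub]

/-- **The diagonal congruence**: for `s > 0`, with `Λ = 1 ⊕ diag(√(βⱼ s^{qⱼ}))`, `Λᵀ M(s) Λ = K(s)`. [folklore] -/
theorem conj_twoBlock (C₁₁ : Matrix ρ₁ ρ₁ ℝ) (C₁₂ : Matrix ρ₁ ρ₂ ℝ) (C₂₂ : Matrix ρ₂ ρ₂ ℝ) (α : ρ₁ → ℝ)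
    (p : ρ₁ → ℕ) {β : ρ₂ → ℝ} (q : ρ₂ → ℕ) (hβ : ∀ j, 0 < β j) {s : ℝ} (hs : 0 < s) :
    (Matrix.fromBlocks (1 : Matrix ρ₁ ρ₁ ℝ) 0 0 (Matrix.diagonal (𝕦[β, q, s])))ᵀ
        * 𝕄[C₁₁, C₁₂, C₂₂, α, p, β, q, s] * Matrix.fromBlocks (1 : Matrix ρ₁ ρ₁ ℝ) 0 0 (Matrix.diagonal (𝕦[β, q, s]))
      = 𝕂[C₁₁, C₁₂, C₂₂, α, p, β, q, s] := by
  have hu2 : ∀ j, Real.sqrt (β j * s ^ q j) * (β j * s ^ q j)⁻¹ * Real.sqrt (β j * s ^ q j) = 1 := by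
    intro j
    have hpos : 0 < β j * s ^ q j := mul_pos (hβ j) (pow_pos hs _)
    calc Real.sqrt (β j * s ^ q j) * (β j * s ^ q j)⁻¹ * Real.sqrt (β j * s ^ q j)
        = (Real.sqrt (β j * s ^ q j) * Real.sqrt (β j * s ^ q j)) * (β j * s ^ q j)⁻¹ := by ring
      _ = 1 := by rw [Real.mul_self_sqrt hpos.le, mul_inv_cancel₀ hpos.ne']
  rw [Matrix.fromBlocks_transpose, Matrix.transpose_one, Matrix.transpose_zero, Matrix.transpose_zero,
    Matrix.diagonal_transpose, Matrix.fromBlocks_multiply, Matrix.fromBlocks_multiply]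
  simp only [Matrix.one_mul, Matrix.zero_mul, Matrix.mul_zero, add_zero, zero_add, Matrix.mul_one]
  rw [Matrix.mul_sub, Matrix.sub_mul, Matrix.diagonal_mul_diagonal, Matrix.diagonal_mul_diagonal]
  congr 2
  rw [← Matrix.diagonal_one]
  congr 1
  funext j
  exact hu2 j

/-! ## §4  The negative family at small scales and the exact inertia -/

/-- **For small `s > 0`: `ν(M(s)) ≥ |ρ₂| + ν(C₁₁)`** (`βⱼ > 0`, `pⱼ, qⱼ ≥ 1`). [folklore] -/
theorem exists_negIndex_twoBlock_ge {C₁₁ : Matrix ρ₁ ρ₁ ℝ} {C₂₂ : Matrix ρ₂ ρ₂ ℝ} (h₁ : C₁₁.IsSymm)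
    (h₂ : C₂₂.IsSymm) (C₁₂ : Matrix ρ₁ ρ₂ ℝ) (α : ρ₁ → ℝ) {p : ρ₁ → ℕ} {β : ρ₂ → ℝ} {q : ρ₂ → ℕ}
    (hβ : ∀ j, 0 < β j) (hp : ∀ j, 1 ≤ p j) (hq : ∀ j, 1 ≤ q j) (hC : C₁₁.IsHermitian) :
    ∃ ε : ℝ, 0 < ε ∧ ∀ s : ℝ, 0 < s → s < ε →
      Fintype.card ρ₂ + Fintype.card {j // hC.eigenvalues j < 0}
        ≤ Fintype.card {j // (isHermitian_twoBlock h₁ h₂ C₁₂ α p β q s).eigenvalues j < 0} := by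
  classical
  -- the joint family: negative eigenvectors of `C₁₁` in the first block, standard vectors in the second
  set Φ : ({j // hC.eigenvalues j < 0} ⊕ ρ₂) → (ρ₁ ⊕ ρ₂ → ℝ) :=
    Sum.elim (fun i => Sum.elim (hC.eigenvectorBasis i.1).ofLp (0 : ρ₂ → ℝ))
      (fun j => Sum.elim (0 : ρ₁ → ℝ) (Pi.single j (1 : ℝ))) with hΦ
  -- it is a negative family for `K(0) = [[C₁₁, 0], [0, −1]]`
  have hK0 : ∀ c : ({j // hC.eigenvalues j < 0} ⊕ ρ₂) → ℝ, c ≠ 0 →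
      (∑ k, c k • Φ k) ⬝ᵥ ((𝕂[C₁₁, C₁₂, C₂₂, α, p, β, q, (0 : ℝ)]) *ᵥ ∑ k, c k • Φ k) < 0 := by
    intro c hc
    rw [rescaled_zero C₁₁ C₁₂ C₂₂ α β hp hq, hΦ, sum_smul_joint, Matrix.fromBlocks_mulVec, Matrix.dotProduct_block]
    simp only [Sum.elim_comp_inl, Sum.elim_comp_inr, Matrix.zero_mulVec, add_zero, zero_add, Matrix.neg_mulVec,
      Matrix.one_mulVec, dotProduct_neg]
    have hz : 0 ≤ (fun j => c (Sum.inr j)) ⬝ᵥ (fun j => c (Sum.inr j)) :=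
      Finset.sum_nonneg fun j _ => mul_self_nonneg _
    by_cases h1 : (fun i => c (Sum.inl i)) = 0
    · have hw : ∑ i, c (Sum.inl i) • ((hC.eigenvectorBasis i.1).ofLp : ρ₁ → ℝ) = 0 :=
        Finset.sum_eq_zero fun i _ => by rw [show c (Sum.inl i) = 0 from congrFun h1 i, zero_smul]
      obtain ⟨j₀, hj₀⟩ : ∃ j, c (Sum.inr j) ≠ 0 := by
        by_contra h
        push Not at h
        apply hc
        funext k
        cases k with
        | inl i => exact congrFun h1 i
        | inr j => exact h j
      rw [hw, zero_dotProduct, zero_add, neg_lt_zero]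
      exact lt_of_lt_of_le (mul_self_pos.2 hj₀)
        (Finset.single_le_sum (f := fun j => c (Sum.inr j) * c (Sum.inr j)) (fun j _ => mul_self_nonneg _)
          (Finset.mem_univ j₀))
    · have hneg := neg_eigenFamily hC (fun i => c (Sum.inl i)) h1
      linarith
  -- persistence near `s = 0`
  have hev := eventually_neg_family (fun s : ℝ => 𝕂[C₁₁, C₁₂, C₂₂, α, p, β, q, s])
    (continuous_rescaled C₁₁ C₁₂ C₂₂ α p β q) Φ 0 hK0
  rw [Metric.eventually_nhds_iff] at hev
  obtain ⟨ε, hε, hε'⟩ := hev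
  refine ⟨ε, hε, fun s hs hsε => ?_⟩
  have hKs := hε' (y := s) (by rw [Real.dist_eq, sub_zero, abs_of_pos hs]; exact hsε)
  have hM := isHermitian_twoBlock h₁ h₂ C₁₂ α p β q s
  -- `M(s)` is negative on the combinations of `Φ`: pull back through the congruence
  have hu : ∀ j, 0 < Real.sqrt (β j * s ^ q j) := fun j => Real.sqrt_pos.2 (mul_pos (hβ j) (pow_pos hs _))
  have h := card_le_negIndex hM Φ fun c hc => ?_
  · rwa [Fintype.card_sum, add_comm] at h
  set c' : ({j // hC.eigenvalues j < 0} ⊕ ρ₂) → ℝ :=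
    Sum.elim (fun i => c (Sum.inl i)) (fun j => c (Sum.inr j) / Real.sqrt (β j * s ^ q j)) with hc'
  have hc'0 : c' ≠ 0 := by
    intro h0
    apply hc
    funext k
    cases k with
    | inl i => exact congrFun h0 (Sum.inl i)
    | inr j =>
      have h' := congrFun h0 (Sum.inr j)
      simp only [hc', Sum.elim_inr, Pi.zero_apply] at h'
      exact (div_eq_zero_iff.1 h').resolve_right (hu j).ne'
  have hΛ : Matrix.fromBlocks (1 : Matrix ρ₁ ρ₁ ℝ) 0 0 (Matrix.diagonal (𝕦[β, q, s])) *ᵥ (∑ k, c' k • Φ k)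
      = ∑ k, c k • Φ k := by
    rw [hΦ, sum_smul_joint, sum_smul_joint, Matrix.fromBlocks_mulVec]
    simp only [Sum.elim_comp_inl, Sum.elim_comp_inr, Matrix.one_mulVec, Matrix.zero_mulVec, add_zero, zero_add, hc',
      Sum.elim_inl, Sum.elim_inr]
    congr 1
    funext j
    rw [Matrix.mulVec_diagonal]
    exact mul_div_cancel₀ _ (hu j).ne'
  have hform := hKs c' hc'0
  rw [← conj_twoBlock C₁₁ C₁₂ C₂₂ α p q hβ hs, ← GramDual.form_conj, hΛ] at hform
  exact hform

/-- Full inertia forces non-degeneracy: `ν(A) + π(A) = card ι ⇒ det A ≠ 0`. [folklore] -/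
theorem det_ne_zero_of_indices {ι : Type} [Fintype ι] [DecidableEq ι] {A : Matrix ι ι ℝ} (hA : A.IsHermitian)
    (h : Fintype.card {j // hA.eigenvalues j < 0} + Fintype.card {j // 0 < hA.eigenvalues j} = Fintype.card ι) :
    A.det ≠ 0 := by
  classical
  have hcnt := negIndex_add_posIndex_add_corank hA
  have hrank : A.rank = Fintype.card ι := by omega
  rw [hA.rank_eq_card_non_zero_eigs] at hrank
  have hall : ∀ j, hA.eigenvalues j ≠ 0 := by
    intro j hj
    have hlt := Fintype.card_subtype_lt (p := fun i => hA.eigenvalues i ≠ 0) (x := j) (not_not.2 hj)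
    omega
  have hprod : A.det = ∏ i, hA.eigenvalues i := by rw [hA.det_eq_prod_eigenvalues]; simp
  rw [hprod]
  exact Finset.prod_ne_zero_iff.2 fun j _ => hall j

/-- **THE TWO-BLOCK DOMINANCE LEMMA.**  `C₁₁`, `C₂₂` real symmetric, `C₁₂` arbitrary, `αⱼ, βⱼ > 0`, `pⱼ, qⱼ ≥ 1`.
There is `ε > 0` such that for every `s ∈ (0, ε)` the matrix
`M(s) = [[C₁₁ + diag(αⱼs^{pⱼ}), C₁₂], [C₁₂ᵀ, C₂₂ − diag((βⱼs^{qⱼ})⁻¹)]]` has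
`ν(M(s)) = |ρ₂| + ν(C₁₁)`, `π(M(s)) + ν(C₁₁) = |ρ₁|`, and `det M(s) ≠ 0`. [folklore] -/
theorem inertia_twoBlock {C₁₁ : Matrix ρ₁ ρ₁ ℝ} {C₂₂ : Matrix ρ₂ ρ₂ ℝ} (h₁ : C₁₁.IsSymm) (h₂ : C₂₂.IsSymm)
    (C₁₂ : Matrix ρ₁ ρ₂ ℝ) {α : ρ₁ → ℝ} {p : ρ₁ → ℕ} {β : ρ₂ → ℝ} {q : ρ₂ → ℕ} (hα : ∀ j, 0 < α j)
    (hβ : ∀ j, 0 < β j) (hp : ∀ j, 1 ≤ p j) (hq : ∀ j, 1 ≤ q j) (hC : C₁₁.IsHermitian) :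
    ∃ ε : ℝ, 0 < ε ∧ ∀ s : ℝ, 0 < s → s < ε →
      Fintype.card {j // (isHermitian_twoBlock h₁ h₂ C₁₂ α p β q s).eigenvalues j < 0}
          = Fintype.card ρ₂ + Fintype.card {j // hC.eigenvalues j < 0}
        ∧ Fintype.card {j // 0 < (isHermitian_twoBlock h₁ h₂ C₁₂ α p β q s).eigenvalues j}
            + Fintype.card {j // hC.eigenvalues j < 0} = Fintype.card ρ₁
        ∧ (𝕄[C₁₁, C₁₂, C₂₂, α, p, β, q, s]).det ≠ 0 := by
  classical
  obtain ⟨ε, hε, hε'⟩ := exists_negIndex_twoBlock_ge h₁ h₂ C₁₂ α hβ hp hq hC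
  refine ⟨ε, hε, fun s hs hsε => ?_⟩
  have hM := isHermitian_twoBlock h₁ h₂ C₁₂ α p β q s
  have hν := hε' s hs hsε
  have hπ := card_nonneg_le_posIndex_fromBlocks hC (fun j => α j * s ^ p j)
    (fun j => mul_pos (hα j) (pow_pos hs _)) C₁₂ C₁₂ᵀ _ hM
  rw [card_nonneg_eigs hC] at hπ
  have hcnt := (negIndex_add_posIndex_add_corank hM).1
  have hle : Fintype.card {j // hC.eigenvalues j < 0} ≤ Fintype.card ρ₁ := Fintype.card_subtype_le _
  rw [Fintype.card_sum] at hcnt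
  have hνeq : Fintype.card {j // hM.eigenvalues j < 0} = Fintype.card ρ₂ + Fintype.card {j // hC.eigenvalues j < 0} := by
    omega
  have hπeq : Fintype.card {j // 0 < hM.eigenvalues j} + Fintype.card {j // hC.eigenvalues j < 0}
      = Fintype.card ρ₁ := by
    omega
  refine ⟨hνeq, hπeq, det_ne_zero_of_indices hM ?_⟩
  rw [Fintype.card_sum]
  omega

end TwoBlock

end Inertia

end Summit.ValiantsHypothesis.ValiantsHypothesis.Theorems.LacunarySymmetroidMatrixDescartes
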